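import Summits.HodgeConjecture.HodgeConjecture.Theorems.F0P2iXvSplitModel       -- ★ p817128: X-side split model
import Summits.HodgeConjecture.HodgeConjecture.Theorems.F0P2iGRDSplitTransport   -- ★ p816908: transport
import Summits.HodgeConjecture.HodgeConjecture.Theorems.F0P3XiLocalLabelsOfMemXiFamily  -- ★ `exists_eq_cmSplitPacket_of_isXiLocalFamily`
import Literature.NumberTheory.Automorphic.Liu2021.CheckOfChiLocal               -- ★ `finAdelicCheck_unitsMap_finiteAdeleSingle_det` (w-reading of the centre character)
import Literature.NumberTheory.Automorphic.Liu2021.LemD1SplitPlaceHeckeEigenvaluesJunction  -- ★ `complexConj_mul_complexConj'`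
import Summits.HodgeConjecture.HodgeConjecture.Theorems.F0P2iThetaTypeCriterion   -- ★ p817306: TTC `thetaTypeAt_of_equiv`
import Mathlib.RingTheory.SimpleModule.Isotypic
import HarnessLib

/-!
# PKΠ rung 4 — row GRD-(S): the split half of the finite Gelbart–Rogawski dictionary

Crux `H413` (item `stmt-HodgeConjecture-24833`), sub-line `Cruxes/H413/Lines/F0_P2PKPiRung4.lean` (v1 ∕ v1.1), stub `stub_GRD`,
predicate `GRDMatrix … ξ μω hμu μ hμ χf`, conjunct **(S)**: at a finite place `v` of `L⁺` SPLIT in `L`, every member of every ξ-local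
family `Pv` (★ D6 `OneDimAutRepH.IsXiLocalFamily`) is a `(μ, χf)`-theta type `ThetaTypeAt … μ hμ χf ε v c` of some line class `ε`.

In print: for a one-dimensional automorphic `ξ` of the quasi-split inner form and a place `v = w w̄` split in `L`, the local A-packet
`Π(ξ_v)` is the singleton `{i_G(ξ_w ⊗ μ_w ∘ det₀)}` [Rogawski1990, §12.2 (2) p. 174, §13.1 p. 199, Lemma 4.13.1 (b) p. 62], and this
parabolically induced representation of `GL₃(L_w)` is the local theta lift of the corresponding character of `U(1)` — Howe duality for the
split dual pair `(GL₃, GL₁)` of type II [Minguez2008, Thm. 1]; [GelbartRogawski1991, §5.1 (5.1.1), Lemma 5.1.2 p. 466].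

In the tree the split member is ★ `cmSplitPacket … (ξ.splitν₀ μω w) (ξ.locψ w) …` with `πn = ⟦splitMemberGL L_w ν₀ χ″ ∘ cmSplitEquiv⟧`
(`ν₀ = splitν₀ ξ μω w`, `χ″ = locψ ξ w`), and the theta type at `v`, pulled back to `GL₃(L_w)` along ★ `localPiSplitEquiv`, is
`i_G(𝟙 ⊗ (θ_w, χ′_w θ_w^{1-3}))` with `θ = toHeckeCharacter L μ` and `χ′_w = χf ∘ (x ↦ x/x̄) ∘ single_w` the `w`-reading of `χf`
(★ p817128 `F0P2iXvSplitModel`, from ★ `Liu2021.SplitPlaceOscillatorModelQuadExtPackage`; transport to `U(H)(L⁺_v)` ★ p816908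
`F0P2iGRDSplitTransport`).  Hence, GIVEN THE SPLIT DICTIONARY IDENTITIES
  `(Dν)  ξ.splitν₀ μω w = (toHeckeCharacter L μ).localComponent w`,
  `(Dψ)  ξ.locψ w = χ′_w * ((toHeckeCharacter L μ).localComponent w) ^ (1 - 3)`
at every `w ∣ v`, `v` split, the member IS the theta type (ε := 1) and conjunct (S) follows from the theta-type criterion ★ p817306
`F0P2iThetaTypeCriterion.thetaTypeAt_of_equiv`.

Main results (namespace `Summit.HodgeConjecture.HodgeConjecture.Cruxes.H413.F0P2iGRDSplit`):
* `wReading_det_eq_localCharOfCenter` — the `w`-reading `χ′_w` of `χf` evaluated on `det z_w` is the centre character `localCharOfCenter … χf v z`;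
* `thetaTypeAt_cmSplitPacket_πn` — (Dν), (Dψ) at one split `w ∣ v` ⟹ `ThetaTypeAt … μ hμ χf 1 v (cmSplitPacket …).πn` (body verbatim, ε := 1);
* `grdMatrix_split_of_dictionary` — (Dν), (Dψ) at all split `(v, w)` ⟹ conjunct (S) of `GRDMatrix … ξ μω hμu μ hμ χf` token for token
  (`ThetaTypeAt` unfolded; the Lines edition folds by `exact`).

NOT in this file (DICT-CHOICE protocol, F0P2-plan (g6) 2026-08-31): the CHOICE of `(μ, χf)` from `ξ, μω` discharging (Dν), (Dψ) — the
witness file `Theorems/F0P2iGRDWitness.lean` (`grdMu`, `grdChi`) — and conjunct (N) (row GRD-(N)).  No `def`, no measure, no sorry.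
-/

set_option autoImplicit false
set_option linter.dupNamespace false

noncomputable section

open scoped Matrix Kronecker MatrixGroups MonoidAlgebra
open NumberField IsDedekindDomain MeasureTheory
open Literature.NumberTheory Literature.NumberTheory.Automorphic Literature.NumberTheory.Automorphic.UnitaryGroup
open Literature.NumberTheory.Automorphic.IdeleClassGroup
open Literature.NumberTheory.Automorphic.Liu2021 Literature.NumberTheory.Automorphic.Liu2021.Def411WeilCarriers
open Literature.NumberTheory.Automorphic.Liu2021.Def411WeilCarriersDoubling
open Literature.NumberTheory.GelbartRogawski1991 Literature.NumberTheory.GelbartRogawski1991.UnitaryDualPair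
open Literature.NumberTheory.GelbartRogawski1991.UnitaryDualPair.WeilCoinv
open Literature.NumberTheory.GelbartRogawski1991.UnitaryDualPair.LocalSplitting
open Literature.RepresentationTheory Literature.RepresentationTheory.Liu2021
open Literature.NumberTheory.GaloisRepresentations Literature.RepresentationTheory.HarrisKudlaSweet1996
open Literature.NumberTheory.Rogawski1990
open Summit.HodgeConjecture.CorCM.Transposition
open Summit.HodgeConjecture.HodgeConjecture.Cruxes.H413

namespace Summit.HodgeConjecture.HodgeConjecture.Cruxes.H413.F0P2iGRDSplit

/-! ## §1 The `w`-reading of the centre character -/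

/-- **The `w`-reading of a character `χf` of `U(1)(𝔸_{L⁺,f})` at a place `w` of `L` over a split `v`** — `χ′_w := χf ∘ (x ↦ x/x̄) ∘ single_w :
L_wˣ →* ℂˣ` (★ `finAdelicCheck`, Mathlib `finiteAdeleSingle`) — read on the determinant of the `w`-component of `z ∈ U(J)(L⁺_v)` (`J` a line form) IS the
centre character ★ `localCharOfCenter … χf v z` (★ `CheckOfChi.finAdelicCheck_unitsMap_finiteAdeleSingle_det`). [cite: Liu2021, Def. 4.11 (l. 2090–2096)]
[cite: Rogawski1990, §12.2 (2) p. 174] -/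
theorem wReading_det_eq_localCharOfCenter (L : Type) [Field L] [NumberField L] [IsCMField L] (ε : (↥(maximalRealSubfield L))ˣ)
    (χf : finAdelicOne (↥(maximalRealSubfield L)) L (IsCMField.complexConj L) →* ℂˣ)
    (v : HeightOneSpectrum (𝓞 ↥(maximalRealSubfield L))) (w : PlacesOver L v) (hw : IsCMField.complexConj L • w.1 ≠ w.1)
    (z : localPi L (IsCMField.complexConj L) 1 (JW (↥(maximalRealSubfield L)) L ε) v) :
    ((χf.comp (finAdelicCheck (↥(maximalRealSubfield L)) L (IsCMField.complexConj L) (Def411WeilCarriers.complexConj_mul_complexConj' L))).comp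
        (Units.map (finiteAdeleSingle w.1)))
        (Matrix.GeneralLinearGroup.det ((z : LocalGLPi L 1 v) w)) =
      localCharOfCenter (↥(maximalRealSubfield L)) L (IsCMField.complexConj L) (JW (↥(maximalRealSubfield L)) L ε)
        (JW_apply_ne_zero (↥(maximalRealSubfield L)) L ε) χf v z := by
  rw [MonoidHom.comp_apply, MonoidHom.comp_apply,
    CheckOfChi.finAdelicCheck_unitsMap_finiteAdeleSingle_det (Def411WeilCarriers.complexConj_mul_complexConj' L)
      (JW_apply_ne_zero (↥(maximalRealSubfield L)) L ε) w hw z]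
  rfl

/-! ## §2 At one split place: the packet member IS the theta type -/

set_option synthInstance.maxHeartbeats 400000 in
set_option maxHeartbeats 16000000 in
/-- **GRD-(S) AT ONE SPLIT PLACE, GIVEN THE DICTIONARY**: for the split member of a ξ-packet read at `w ∣ v` — the class of
`i_G(ξ_w) ∘ cmSplitEquiv` with labels `ν₀ = splitν₀ ξ μω w`, `χ′′ = locψ ξ w` — and a pair `(μ, χf)` satisfying the split dictionary at `w`
(`ν₀ = μ_w`, `χ′′ = χ′_w · μ_w⁻²`, `χ′_w` the `w`-reading of `χf`), `ThetaTypeAt … μ hμ χf 1 v c` (body verbatim, `ε := 1`).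
Proof: ★ p817128 (X-side split model) + ★ p816908 (transport to `U(H)(L⁺_v)`) give `X_v(μ,1,χf) ∘ κ_v⁻¹ ≃ i_G(𝟙 ⊗ (μ_w, χ′_w μ_w^{-2})) ∘ localPiSplitEquiv`;
rewrite the Levi labels by the dictionary; the member `⟦i_G(ξ_w) ∘ cmSplitEquiv⟧` pulled back along ★ `localPiEquiv` is that representation on the nose;
conclude by the theta-type criterion ★ p817306. [cite: Rogawski1990, Lemma 4.13.1 (b) p. 62; §12.2 (2) p. 174; §13.1 p. 199] [cite: Minguez2008, Thm. 1]
[cite: GelbartRogawski1991, §5.1 (5.1.1), Lem 5.1.2 p. 466] [cite: Liu2021, Def. 4.11 (l. 2090–2096)] -/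
theorem thetaTypeAt_cmSplitPacket_πn
    (L : Type) [Field L] [NumberField L] [IsCMField L] (H : Matrix (Fin 3) (Fin 3) L) (hH : (H.map (cmConjRingHom L))ᵀ = H) (hHd : IsUnit H.det)
    {n' : ℕ} (e₁ : Fin 3 × Fin 1 ≃ Fin n') (dV : Fin 3 → L) (hdV : ∀ i, IsCMField.complexConj L (dV i) = dV i) (hdV0 : ∀ i, dV i ≠ 0) (g : GL (Fin 3) L)
    (hg : ((g : Matrix (Fin 3) (Fin 3) L).map (cmConjRingHom L))ᵀ * H * (g : Matrix (Fin 3) (Fin 3) L) = Matrix.diagonal dV)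
    (ξ : OneDimAutRepH L) (μω : HeckeCharacter L) (hμu : μω.IsUnitary)
    (μ : Literature.NumberTheory.Automorphic.IdeleClassGroup L →ₜ* Circle) (hμ : IsConjugateSymplectic L μ)
    (χf : UnitaryGroup.finAdelicOne (↥(maximalRealSubfield L)) L (IsCMField.complexConj L) →* ℂˣ)
    (hχfu : ∀ z, ‖((χf z : ℂˣ) : ℂ)‖ = 1) (hχfc : Continuous χf)
    (v : HeightOneSpectrum (𝓞 ↥(maximalRealSubfield L))) (w : PlacesOver L v) (hw : IsCMField.complexConj L • w.1 ≠ w.1)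
    (hν : ξ.splitν₀ μω w.1 = (toHeckeCharacter L μ).localComponent w.1)
    (hψ : ξ.locψ w.1 =
      ((χf.comp (finAdelicCheck (↥(maximalRealSubfield L)) L (IsCMField.complexConj L) (Def411WeilCarriers.complexConj_mul_complexConj' L))).comp
          (Units.map (finiteAdeleSingle w.1))) * ((toHeckeCharacter L μ).localComponent w.1) ^ (1 - ((3 : ℕ) : ℤ)))
    (c : IrrClass ((cmDatum L 3 H).Local v))
    (hc : c = (cmSplitPacket L H hH hHd v w hw (ξ.splitν₀ μω w.1) (ξ.locψ w.1) (ξ.norm_splitν₀_apply hμu w.1)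
        (ξ.continuous_splitν₀ μω w.1) (ξ.norm_locψ_apply w.1) (ξ.continuous_locψ w.1)).πn) :
    letI ε : (↥(maximalRealSubfield L))ˣ := 1
    ∀ (T : Type) [AddCommGroup T] [Module ℂ T] (τ : Representation ℂ ↥(localPi L (IsCMField.complexConj L) 3 H v) T), τ.IsIrreducible →
    (IrrClass.comap (localPiEquiv L (IsCMField.complexConj L) 3 H v) c).IsConstituentOf τ →
    ∀ (W' : Type) [AddCommGroup W'] [Module ℂ W'] (ρ' : Representation ℂ ↥(localPi L (IsCMField.complexConj L) 3 H v) W'),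
      isotypicComponent (MonoidAlgebra ℂ (localPi L (IsCMField.complexConj L) 3 H v)) (Representation.asModule ρ')
          (Representation.asModule τ) = ⊤ →
      isotypicComponent (MonoidAlgebra ℂ (localPi L (IsCMField.complexConj L) 3 H v)) (Representation.asModule ρ')
        (Representation.asModule
          (((show Representation ℂ (localPi L (IsCMField.complexConj L) 3 (Matrix.diagonal dV) v) _ from
            (TwistedCoinv.rep (localCharOfCenter (↥(maximalRealSubfield L)) L (IsCMField.complexConj L)
                (JW (↥(maximalRealSubfield L)) L ε) (JW_apply_ne_zero (↥(maximalRealSubfield L)) L ε) χf v)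
              ((OmegaChiSplitting.chiLocalSplittingsD ⟨L⟩ e₁ dV hdV hdV0 (toHeckeCharacter L μ)
                ((isOscillatorChar_toHeckeCharacter_iff μ).mpr hμ) ε).omegaLoc v)
              (commute_omegaLoc_localCenter (↥(maximalRealSubfield L)) L (IsCMField.complexConj L) 3 e₁ (Matrix.diagonal dV)
                (JW (↥(maximalRealSubfield L)) L ε) (complexConj_imagUnit L) (imagUnit_ne_zero L) (imagUnit_mul_self L)
                (realDiagonal_isSymm L dV hdV) (isSymm_TW (↥(maximalRealSubfield L)) ε) (realDiagonal_map L dV hdV).symm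
                (JW_eq (↥(maximalRealSubfield L)) L ε) (JW_apply_ne_zero (↥(maximalRealSubfield L)) L ε)
                (OmegaChiSplitting.chiLocalSplittingsD ⟨L⟩ e₁ dV hdV hdV0 (toHeckeCharacter L μ)
                  ((isOscillatorChar_toHeckeCharacter_iff μ).mpr hμ) ε) v)).comp
              (UnitaryGroup.localLineInl L (IsCMField.complexConj L) 3 e₁ (Matrix.diagonal dV) (JW (↥(maximalRealSubfield L)) L ε) v)) :
              localPi L (IsCMField.complexConj L) 3 (Matrix.diagonal dV) v →* _).comp
            (localCongr L (IsCMField.complexConj L) g one_ne_zero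
              (F0P2cOmegaLocalType.formCongr_frame L H dV g hg) v).symm.toMulEquiv.toMonoidHom)) = ⊤ := by
  subst hc
  -- `n' = 3`
  obtain rfl : n' = 3 := by
    have h := Fintype.card_congr e₁
    simp only [Fintype.card_prod, Fintype.card_fin] at h
    omega
  have hc1 : IsCMField.complexConj L ≠ 1 := IsCMField.complexConj_ne_one L
  have hHh : (H.map (IsCMField.complexConj L))ᵀ = H := (UnitaryGroup.map_cmConjRingHom_eq_map_complexConj L H) ▸ hH
  have hHw : IsUnit (placeForm H w.1) := UnitaryGroup.isUnit_placeForm_of_isUnit_det hHd w.1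
  have hJh := reindex_kronecker_JW_hermitian (↥(maximalRealSubfield L)) L (IsCMField.complexConj L) 3 e₁ (Matrix.diagonal dV)
    (realDiagonal_isSymm L dV hdV) (realDiagonal_map L dV hdV).symm (1 : (↥(maximalRealSubfield L))ˣ)
  have hJw : IsUnit (placeForm (Matrix.reindex e₁ e₁ (Matrix.diagonal dV ⊗ₖ JW (↥(maximalRealSubfield L)) L (1 : (↥(maximalRealSubfield L))ˣ))) w.1) :=
    UnitaryGroup.isUnit_placeForm_of_isUnit_det
      (isUnit_iff_ne_zero.2 (det_reindex_kronecker_JW_ne_zero (↥(maximalRealSubfield L)) L 3 e₁ (Matrix.diagonal dV)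
        (isUnit_det_realDiagonal L dV hdV hdV0) (realDiagonal_map L dV hdV).symm (1 : (↥(maximalRealSubfield L))ˣ))) w.1
  -- the X-side split model at `w` (★ p817128) and its transport to `U(H)(L⁺_v)` (★ p816908)
  have hXI := F0P2iXvSplitModel.areIsomorphicRep_chiCoinv_chiLocalSplittingsD_split L hc1 (by norm_num) e₁ dV hdV hdV0
    (toHeckeCharacter L μ) ((isOscillatorChar_toHeckeCharacter_iff μ).mpr hμ) (isUnitary_toHeckeCharacter L μ) (1 : (↥(maximalRealSubfield L))ˣ) χf hχfu hχfc v w hw hJh hJw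
    _ (wReading_det_eq_localCharOfCenter L (1 : (↥(maximalRealSubfield L))ˣ) χf v w hw)
  obtain ⟨E⟩ := F0P2iGRDSplitTransport.nonempty_equiv_comp_localLineInl_localCongr_symm L H dV g hg e₁ (JW (↥(maximalRealSubfield L)) L (1 : (↥(maximalRealSubfield L))ˣ)) v w hw
    hc1 hHh hHw hJh hJw _ _ hXI
  -- the dictionary: rewrite the model's Levi characters into the packet's labels
  rw [← hψ, ← hν] at E
  -- the member representation, pulled back to `localPi v`, IS the pulled-back model (pointwise), hence `≃ X ∘ localLineInl ∘ κ_v⁻¹`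
  let r₀ : SmoothIrrep ↥(localPi L (IsCMField.complexConj L) 3 H v) :=
    ((splitMemberGL (w.1.adicCompletion L) (ξ.splitν₀ μω w.1) (ξ.locψ w.1) (ξ.norm_splitν₀_apply hμu w.1)
        (ξ.continuous_splitν₀ μω w.1) (ξ.norm_locψ_apply w.1) (ξ.continuous_locψ w.1)).comap (cmSplitEquiv L H hH hHd v w hw)).comap
      (localPiEquiv L (IsCMField.complexConj L) 3 H v)
  have hmk : IrrClass.mk r₀ = IrrClass.comap (localPiEquiv L (IsCMField.complexConj L) 3 H v)
      (cmSplitPacket L H hH hHd v w hw (ξ.splitν₀ μω w.1) (ξ.locψ w.1) (ξ.norm_splitν₀_apply hμu w.1)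
        (ξ.continuous_splitν₀ μω w.1) (ξ.norm_locψ_apply w.1) (ξ.continuous_locψ w.1)).πn := rfl
  have eMem : r₀.ρ.Equiv
      (show Representation ℂ (localPi L (IsCMField.complexConj L) 3 H v) _ from
        (splitMemberGL (w.1.adicCompletion L) (ξ.splitν₀ μω w.1) (ξ.locψ w.1) (ξ.norm_splitν₀_apply hμu w.1)
          (ξ.continuous_splitν₀ μω w.1) (ξ.norm_locψ_apply w.1) (ξ.continuous_locψ w.1)).ρ.comp
          (localPiSplitEquiv (IsCMField.complexConj L) H hc1 hHh w hw hHw).toMonoidHom) := by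
    refine Representation.Equiv.mk (LinearEquiv.refl ℂ _) fun u => ?_
    apply LinearMap.ext
    intro x
    change (splitMemberGL (w.1.adicCompletion L) (ξ.splitν₀ μω w.1) (ξ.locψ w.1) (ξ.norm_splitν₀_apply hμu w.1)
          (ξ.continuous_splitν₀ μω w.1) (ξ.norm_locψ_apply w.1) (ξ.continuous_locψ w.1)).ρ
        (localPiSplitEquiv (IsCMField.complexConj L) H hc1 hHh w hw hHw
          ((localPiEquiv L (IsCMField.complexConj L) 3 H v).symm (localPiEquiv L (IsCMField.complexConj L) 3 H v u))) x = _
    rw [ContinuousMulEquiv.symm_apply_apply]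
    rfl
  have e₀ := eMem.trans E.symm
  -- THETA-TYPE CRITERION (★ TTC p817306)
  exact F0P2iThetaTypeCriterion.thetaTypeAt_of_equiv L H e₁ dV hdV hdV0 g hg μ hμ χf 1 v _ r₀ hmk e₀

/-! ## §3 Conjunct (S) of `GRDMatrix`, given the dictionary at all split places -/

set_option synthInstance.maxHeartbeats 400000 in
set_option maxHeartbeats 16000000 in
/-- **GRD-(S) — THE SPLIT HALF OF THE FINITE GELBART–ROGAWSKI DICTIONARY, GIVEN THE SPLIT DICTIONARY IDENTITIES.**  Conjunct (S) of the sub-line's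
`GRDMatrix L H hH hHd e₁ dV hdV hdV0 g hg ξ μω hμu μ hμ χf` token for token (`ThetaTypeAt` unfolded; fold by `exact` in the Lines edition), for every pair
`(μ, χf)` — `χf` unitary and continuous — satisfying at every place `w ∣ v` of `L` over a split `v` the two identities of [Rogawski1990, Lemma 4.13.1 (b);
§12.2 (2)] ∕ [Minguez2008, Thm. 1] in the tree's normalisations: `splitν₀ ξ μω w = μ_w` and `locψ ξ w = χ′_w · μ_w^{1-3}` (`χ′_w = χf ∘ (x ↦ x/x̄) ∘ single_w`).
Proof: a ξ-local family is the singleton ★ `cmSplitPacket` at a split place (★ `exists_eq_cmSplitPacket_of_isXiLocalFamily`, ★ `cmSplitPacket_members`), and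
`thetaTypeAt_cmSplitPacket_πn` (ε := 1). [cite: Rogawski1990, Lemma 4.13.1 (b) p. 62; §12.2 (2) p. 174; §13.1 p. 199] [cite: Minguez2008, Thm. 1]
[cite: GelbartRogawski1991, §5.1 (5.1.1), Lem 5.1.2 p. 466] -/
theorem grdMatrix_split_of_dictionary
    (L : Type) [Field L] [NumberField L] [IsCMField L] (H : Matrix (Fin 3) (Fin 3) L) (hH : (H.map (cmConjRingHom L))ᵀ = H) (hHd : IsUnit H.det)
    {n' : ℕ} (e₁ : Fin 3 × Fin 1 ≃ Fin n') (dV : Fin 3 → L) (hdV : ∀ i, IsCMField.complexConj L (dV i) = dV i) (hdV0 : ∀ i, dV i ≠ 0) (g : GL (Fin 3) L)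
    (hg : ((g : Matrix (Fin 3) (Fin 3) L).map (cmConjRingHom L))ᵀ * H * (g : Matrix (Fin 3) (Fin 3) L) = Matrix.diagonal dV)
    (ξ : OneDimAutRepH L) (μω : HeckeCharacter L) (hμu : μω.IsUnitary)
    (μ : Literature.NumberTheory.Automorphic.IdeleClassGroup L →ₜ* Circle) (hμ : IsConjugateSymplectic L μ)
    (χf : UnitaryGroup.finAdelicOne (↥(maximalRealSubfield L)) L (IsCMField.complexConj L) →* ℂˣ)
    (hχfu : ∀ z, ‖((χf z : ℂˣ) : ℂ)‖ = 1) (hχfc : Continuous χf)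
    (hν : ∀ (v : HeightOneSpectrum (𝓞 ↥(maximalRealSubfield L))) (w : PlacesOver L v), IsCMField.complexConj L • w.1 ≠ w.1 →
      ξ.splitν₀ μω w.1 = (toHeckeCharacter L μ).localComponent w.1)
    (hψ : ∀ (v : HeightOneSpectrum (𝓞 ↥(maximalRealSubfield L))) (w : PlacesOver L v), IsCMField.complexConj L • w.1 ≠ w.1 →
      ξ.locψ w.1 =
        ((χf.comp (finAdelicCheck (↥(maximalRealSubfield L)) L (IsCMField.complexConj L) (Def411WeilCarriers.complexConj_mul_complexConj' L))).comp
            (Units.map (finiteAdeleSingle w.1))) * ((toHeckeCharacter L μ).localComponent w.1) ^ (1 - ((3 : ℕ) : ℤ))) :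
    ∀ Pv : ∀ v : HeightOneSpectrum (𝓞 ↥(maximalRealSubfield L)), CMLocalAPacket L H v,
      ξ.IsXiLocalFamily hH hHd μω hμu Pv →
      ∀ (v : HeightOneSpectrum (𝓞 ↥(maximalRealSubfield L))),
        (∃ w : PlacesOver L v, IsCMField.complexConj L • w.1 ≠ w.1) →
        ∀ c : IrrClass ((cmDatum L 3 H).Local v), c ∈ (Pv v).members →
          ∃ ε : (↥(maximalRealSubfield L))ˣ,
          ∀ (T : Type) [AddCommGroup T] [Module ℂ T] (τ : Representation ℂ ↥(localPi L (IsCMField.complexConj L) 3 H v) T), τ.IsIrreducible →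
          (IrrClass.comap (localPiEquiv L (IsCMField.complexConj L) 3 H v) c).IsConstituentOf τ →
          ∀ (W' : Type) [AddCommGroup W'] [Module ℂ W'] (ρ' : Representation ℂ ↥(localPi L (IsCMField.complexConj L) 3 H v) W'),
            isotypicComponent (MonoidAlgebra ℂ (localPi L (IsCMField.complexConj L) 3 H v)) (Representation.asModule ρ')
                (Representation.asModule τ) = ⊤ →
            isotypicComponent (MonoidAlgebra ℂ (localPi L (IsCMField.complexConj L) 3 H v)) (Representation.asModule ρ')
              (Representation.asModule
                (((show Representation ℂ (localPi L (IsCMField.complexConj L) 3 (Matrix.diagonal dV) v) _ from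
                  (TwistedCoinv.rep (localCharOfCenter (↥(maximalRealSubfield L)) L (IsCMField.complexConj L)
                      (JW (↥(maximalRealSubfield L)) L ε) (JW_apply_ne_zero (↥(maximalRealSubfield L)) L ε) χf v)
                    ((OmegaChiSplitting.chiLocalSplittingsD ⟨L⟩ e₁ dV hdV hdV0 (toHeckeCharacter L μ)
                      ((isOscillatorChar_toHeckeCharacter_iff μ).mpr hμ) ε).omegaLoc v)
                    (commute_omegaLoc_localCenter (↥(maximalRealSubfield L)) L (IsCMField.complexConj L) 3 e₁ (Matrix.diagonal dV)
                      (JW (↥(maximalRealSubfield L)) L ε) (complexConj_imagUnit L) (imagUnit_ne_zero L) (imagUnit_mul_self L)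
                      (realDiagonal_isSymm L dV hdV) (isSymm_TW (↥(maximalRealSubfield L)) ε) (realDiagonal_map L dV hdV).symm
                      (JW_eq (↥(maximalRealSubfield L)) L ε) (JW_apply_ne_zero (↥(maximalRealSubfield L)) L ε)
                      (OmegaChiSplitting.chiLocalSplittingsD ⟨L⟩ e₁ dV hdV hdV0 (toHeckeCharacter L μ)
                        ((isOscillatorChar_toHeckeCharacter_iff μ).mpr hμ) ε) v)).comp
                    (UnitaryGroup.localLineInl L (IsCMField.complexConj L) 3 e₁ (Matrix.diagonal dV) (JW (↥(maximalRealSubfield L)) L ε) v)) :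
                    localPi L (IsCMField.complexConj L) 3 (Matrix.diagonal dV) v →* _).comp
                  (localCongr L (IsCMField.complexConj L) g one_ne_zero
                    (F0P2cOmegaLocalType.formCongr_frame L H dV g hg) v).symm.toMulEquiv.toMonoidHom)) = ⊤ := by
  intro Pv hPv v hsplit c hc
  obtain ⟨w, hw, hPvw⟩ := F0P3XiLocalLabelsOfMemXiFamily.exists_eq_cmSplitPacket_of_isXiLocalFamily hH hHd ξ μω hμu hPv v hsplit
  rw [hPvw, cmSplitPacket_members, Set.mem_singleton_iff] at hc
  exact ⟨1, thetaTypeAt_cmSplitPacket_πn L H hH hHd e₁ dV hdV hdV0 g hg ξ μω hμu μ hμ χf hχfu hχfc v w hw (hν v w hw) (hψ v w hw) c hc⟩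

end Summit.HodgeConjecture.HodgeConjecture.Cruxes.H413.F0P2iGRDSplit

end
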